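import Literature.AlgebraicGeometry.HodgeTheory.GAGADifferentialFormsProjectiveSpace
import Literature.Algebra.Homology.SerreFinitenessH0
import HarnessLib

/-!
# Consequences of GAGA for `Ω^p_{ℙ_r}(n)`: vanishing above degree `r` and finiteness of the
# holomorphic Čech cohomology (Cartan–Serre for the sheaves of twisted differential forms)

Read off from the algebraic side through the GAGA quasi-isomorphism
`GAGAForms.quasiIso_cechComparison` (`GAGADifferentialFormsProjectiveSpace.lean`):

* `GAGAForms.moduleFinite_homology_cech_Zsub` — **Serre's algebraic finiteness theorem for
  `Ω^p_{ℙ_r}(n)`**: every cohomology module `Hᵃ(Č_n(Z_p))` of the algebraic Čech complex of the graded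
  kernel module `Z_p` (`GAGAForms.Zsub`, `Γ_*(Ω^p)`) is a finite-dimensional `ℂ`-vector space
  (Serre, FAC n° 66 Thm. 1: `H^q(X, 𝓕)` finite-dimensional for `𝓕` coherent on projective `X`) —
  proved as Serre proves it, by descending induction along exact sequences: here along the short
  exact sequences `0 → Č(Z_{p+1}) → Č(Λ^{p+1}) → Č(Z_p) → 0` of the Koszul–Čech engine
  (`KoszulCech.Datum.shortExact_ses`), from the explicit cohomology of the free sheaves
  (`LaurentCech.moduleFinite_homology_cech_top`), Serre's `H⁰` finiteness
  (`LaurentCech.moduleFinite_homology_cech_zero`) and the vanishing of `Z_p` for `p > r + 1`;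
* `GAGAForms.isZero_homology_holCech_of_lt` — `Ȟᵃ(𝔘^h, Ω^p(n)^h) = 0` for `a > r`;
* `GAGAForms.moduleFinite_homology_holCech` — **`Ȟᵃ(𝔘^h, Ω^p(n)^h)` is finite-dimensional for every
  `a`** (the Cartan–Serre finiteness theorem for these coherent analytic sheaves on the compact
  manifold `ℙ_r(ℂ)`, obtained — as in GAGA n° 12, Théorème 1 with FAC n° 66 — by transport from the
  algebraic side).

Theorems only; no named facts.

## References
* [SerreFAC1955] J.-P. Serre, *Faisceaux algébriques cohérents*, Ann. of Math. 61 (1955), n° 66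
  Théorème 1 (finiteness of `H^q(X, 𝓕)` for coherent `𝓕` on a projective variety).
* [SerreGAGA1956] J.-P. Serre, *Géométrie algébrique et géométrie analytique* (1956), n° 12
  Théorème 1, n° 13.
* [CartanSerre1953] H. Cartan, J.-P. Serre, *Un théorème de finitude concernant les variétés
  analytiques compactes*, C. R. Acad. Sci. Paris 237 (1953), 128–130.
-/

noncomputable section

open CategoryTheory CategoryTheory.Limits

namespace Literature.AlgebraicGeometry.HodgeTheory

namespace GAGAForms

open Literature.Algebra.Homology Literature.Algebra.Homology.LaurentCech
  Literature.Algebra.Homology.OrderedCech Literature.Algebra.Homology.KoszulCech GAGATwist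

variable {r : ℕ}

/-! ### The algebraic side: Serre's finiteness for `Ω^p(n)` by the Koszul dévissage -/

/-- The terms of the algebraic Čech complex of `Z_p` in degrees `p > r + 1` are zero (there are no
`p`-subsets of `{0, …, r}`). [cite: SerreFAC1955, n° 66 Thm. 1] -/
theorem isZero_homology_cech_Zsub_of_card_lt (n : ℤ) {p : ℕ} (hp : r + 1 < p) (a : ℤ) :
    IsZero ((LaurentCech.cech (fun _ : Sub (Fin (r + 1)) p => (p : ℤ)) (Zsub r p) n).homology a) :=
  (HomologicalComplex.exactAt_iff_isZero_homology _ _).mp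
    (HomologicalComplex.ExactAt.of_isZero
      ((algDatum r n).isZero_kerCx_X (by rw [Fintype.card_fin]; exact hp) a))

/-- **Serre's finiteness for `Ω^p_{ℙ_r}(n)` in positive Čech degrees**, by descending induction on
`p` along `0 → Č(Z_{p+1}) → Č(Λ^{p+1}) → Č(Z_p) → 0`: the exact piece
`Hᵃ(Č(Λ^{p+1})) → Hᵃ(Č(Z_p)) → Hᵃ⁺¹(Č(Z_{p+1}))` has finite-dimensional outer terms.
[cite: SerreFAC1955, n° 66 Thm. 1] -/
theorem moduleFinite_homology_cech_Zsub_of_pos (n : ℤ) (p : ℕ) {a : ℤ} (ha : 1 ≤ a) :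
    Module.Finite ℂ ((LaurentCech.cech (fun _ : Sub (Fin (r + 1)) p => (p : ℤ)) (Zsub r p) n).homology a) := by
  -- descending induction: `∀ k p, r + 2 ≤ p + k → ∀ a ≥ 1, finite`
  suffices key : ∀ k p, r + 2 ≤ p + k → ∀ a : ℤ, 1 ≤ a →
      Module.Finite ℂ ((LaurentCech.cech (fun _ : Sub (Fin (r + 1)) p => (p : ℤ)) (Zsub r p) n).homology a)
    from key (r + 2) p (by omega) a ha
  intro k
  induction k with
  | zero =>
    intro p hp a _
    exact moduleFinite_of_isZero (isZero_homology_cech_Zsub_of_card_lt n (by omega) a)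
  | succ k ih =>
    intro p hp a ha
    have hS := (algDatum r n).shortExact_ses uL_mul_xL p
    have hex := hS.homology_exact₃ a (a + 1) (by simp)
    haveI : Module.Finite ℂ (((algDatum r n).ses p).X₂.homology a) :=
      moduleFinite_homology_cech_top (A := ℂ) (r := r)
        (fun _ : Sub (Fin (r + 1)) (p + 1) => ((p + 1 : ℕ) : ℤ)) n a ha
    haveI : Module.Finite ℂ (((algDatum r n).ses p).X₁.homology (a + 1)) :=
      ih (p + 1) (by omega) (a + 1) (by omega)
    exact moduleFinite_X₂_of_exact _ hex

/-- **Serre's finiteness theorem for `Ω^p_{ℙ_r}(n)`, algebraic Čech form, all degrees**: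
`Hᵃ(Č_n(Z_p))` is a finite-dimensional `ℂ`-vector space (`a ≥ 1` by the Koszul dévissage, `a = 0`
by Serre's `H⁰` finiteness `LaurentCech.moduleFinite_homology_cech_zero`, `a < 0` zero).
[cite: SerreFAC1955, n° 66 Thm. 1] -/
theorem moduleFinite_homology_cech_Zsub (n : ℤ) (p : ℕ) (a : ℤ) :
    Module.Finite ℂ ((LaurentCech.cech (fun _ : Sub (Fin (r + 1)) p => (p : ℤ)) (Zsub r p) n).homology a) := by
  rcases lt_trichotomy a 0 with ha | rfl | ha
  · exact moduleFinite_homology_cech_of_neg _ _ n a ha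
  · exact moduleFinite_homology_cech_zero _ _ n
  · exact moduleFinite_homology_cech_Zsub_of_pos n p (by omega)

/-! ### The holomorphic side, by GAGA -/

/-- **`Ȟᵃ(𝔘^h, Ω^p(n)^h) = 0` for `a > r`** on `ℙ_r(ℂ)` (the standard cover has `r + 1` members; read
off through the GAGA quasi-isomorphism). [cite: SerreGAGA1956, n° 12 Théorème 1] -/
theorem isZero_homology_holCech_of_lt (p : ℕ) (n : ℤ) {a : ℤ} (ha : (r : ℤ) < a) :
    IsZero ((holCech r p n).homology a) := by
  haveI := isIso_homologyMap_cechComparison (r := r) p n a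
  exact (isZero_homology_cech_of_lt (fun _ : Sub (Fin (r + 1)) p => (p : ℤ)) (Zsub r p) n a ha).of_iso
    (asIso (HomologicalComplex.homologyMap (cechComparison r p n) a)).symm

/-- **Cartan–Serre finiteness for `Ω^p_{ℙ_r}(n)^h`, Čech form: `Ȟᵃ(𝔘^h, Ω^p(n)^h)` is a
finite-dimensional `ℂ`-vector space for every `a`** — transported from Serre's algebraic finiteness
through GAGA Théorème 1 (`quasiIso_cechComparison`).
[cite: SerreGAGA1956, n° 12 Théorème 1] [cite: CartanSerre1953, Théorème] -/
theorem moduleFinite_homology_holCech (p : ℕ) (n a : ℤ) :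
    Module.Finite ℂ ((holCech r p n).homology a) := by
  haveI := moduleFinite_homology_cech_Zsub (r := r) n p a
  haveI := isIso_homologyMap_cechComparison (r := r) p n a
  exact Module.Finite.equiv
    (asIso (HomologicalComplex.homologyMap (cechComparison r p n) a)).toLinearEquiv

end GAGAForms

end Literature.AlgebraicGeometry.HodgeTheory
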